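import Summits.Ventures.PercRepro.G3ClassAll
import Summits.Ventures.PercRepro.PairCert

/-!
# Lemma 5 on `g3 = gadget + v–m₄` for EVERY weight vector: a class-level PAIR certificate (p6, gen 6)

`g3` (`G3Table.lean`) is the gadget with the edge `v–m₄`: the smallest member of the family on
which every `Z`-fibre copositivity certificate of gen 5 failed.  At the FULL class level
(`S = E ∖ {g}`, nested sums over the `3⁸ = 6,561` classes `(I ⊆ U ⊆ S)`, all INTEGER halves through
the certified row table) the picture is simple: exactly TWO classes are positive — `(∅, S ∖ {v–m₄})`,
the gadget's all-differ class with `v–m₄` closed in both copies, and `(∅, S)`, all nine free edges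
differing — each with nested sum `+1`, and each has a DEDICATED complementary pair of negative
classes with nested sums `−1, −1`: the «copies» of the bad pair on the `Z`-edges `{v–H}` and
`{v–m₂, a–H}`.  The weight identity `w(P₁) w(P₂) = w(C)²` holds edge by edge (profiles
`(1_I + 1_U)` average), so the three-term AM-GM of `PairCert.lean` pays each positive class with
shares `1` of its own two partners, and every other class is `≤ 0` (kernel computation:
`classOK_0..15`, `65,536` kernel values of `kA3`).

* `deltaVec_forcePat_S3`, `quadPlus_forcePat_S3`, `nestedSum_g3` (the real-valued glue; the kernel half is
  `G3Class.lean`);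
* **`g3_deltaQuad_nonpos`**, **`g3_phiPlus_concave`**.
-/

-- the kernel checks below are heavy; elaborate them one at a time (memory; p3 g9 finding 21:02:37Z)
set_option Elab.async false

namespace PercRepro

open Finset

/-! ### Fully forced patterns of `g3`: merge vectors through the certified table -/

/-- Forcing the pattern and then opening edge `3` gives the deterministic weights of the open pattern configuration. -/
theorem update_forcePat3_one (p : Fin 9 → ℝ) (A : Finset (Fin 9)) :
    Function.update (forcePat p S3 A) 3 (1 : ℝ) = detWeights (patCfg3 A true) := by
  funext e
  by_cases he : e = 3
  · subst he
    simp [detWeights, patCfg3]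
  · have heS : e ∈ S3 := mem_S3_of_ne he
    simp [forcePat, detWeights, patCfg3, heS, he]

/-- Forcing the pattern and then closing edge `3` gives the deterministic weights of the closed pattern configuration. -/
theorem update_forcePat3_zero (p : Fin 9 → ℝ) (A : Finset (Fin 9)) :
    Function.update (forcePat p S3 A) 3 (0 : ℝ) = detWeights (patCfg3 A false) := by
  funext e
  by_cases he : e = 3
  · subst he
    simp [detWeights, patCfg3]
  · have heS : e ∈ S3 := mem_S3_of_ne he
    simp [forcePat, detWeights, patCfg3, heS, he]

/-- The merge vector of a fully forced pattern of `g3` is the difference of two basis rows, read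
through the certified table `rowT3`. -/
theorem deltaVec_forcePat_S3 (p : Fin 9 → ℝ) (A : Finset (Fin 9)) :
    g3.deltaVec (forcePat p S3 A) 3 0 1 2 3 =
      fun r => rowVec (rowT3 (patCfg3 A true)) r - rowVec (rowT3 (patCfg3 A false)) r := by
  funext r
  have h1 : row4 (g3.markedPartition (patCfg3 A true) ![0, 1, 2, 3]) = rowT3 (patCfg3 A true) := by
    rw [show (![0, 1, 2, 3] : Fin 4 → Fin 6) = m0 from rfl, rowD3_eq, rowD3_eq_table]
  have h0 : row4 (g3.markedPartition (patCfg3 A false) ![0, 1, 2, 3]) = rowT3 (patCfg3 A false) := by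
    rw [show (![0, 1, 2, 3] : Fin 4 → Fin 6) = m0 from rfl, rowD3_eq, rowD3_eq_table]
  simp only [MultiGraph.deltaVec, update_forcePat3_one, update_forcePat3_zero,
    MultiGraph.law4_detWeights, rowVec, h1, h0]

/-- The positive quadratic form of two forced patterns, in terms of the pattern configurations. -/
theorem quadPlus_forcePat_S3 (p : Fin 9 → ℝ) (A A' : Finset (Fin 9)) :
    quadPlus (g3.deltaVec (forcePat p S3 A) 3 0 1 2 3) (g3.deltaVec (forcePat p S3 A') 3 0 1 2 3) =
      (1 / 2 : ℝ) * (kA3 A A' : ℝ) := by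
  rw [deltaVec_forcePat_S3, deltaVec_forcePat_S3, quadPlus_basis, kA3]
  push_cast
  ring

/-- On `g3` every nested sum of the full class level is half an integer class sum. -/
theorem nestedSum_g3 (p : Fin 9 → ℝ) {I U : Finset (Fin 9)} (hI : I ⊆ U) (hU : U ⊆ S3) :
    g3.nestedSum p S3 3 0 1 2 3 I U = (1 / 2 : ℝ) * (cT I U : ℝ) := by
  unfold MultiGraph.nestedSum cT
  rw [sum_fibre_eq S3 hI hU]
  push_cast
  rw [Finset.mul_sum]
  refine Finset.sum_congr rfl fun τ _ => ?_
  exact quadPlus_forcePat_S3 p _ _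

/-! ### Lemma 5 on `g3` -/

/-- The two positive classes. -/
def negC : Finset (Finset (Fin 9) × Finset (Fin 9)) :=
  {(∅, {0, 1, 2, 4, 5, 6, 7}), (∅, {0, 1, 2, 4, 5, 6, 7, 8})}

/-- The four paying classes. -/
def payC : Finset (Finset (Fin 9) × Finset (Fin 9)) :=
  {({7}, {0, 1, 5, 6, 7}), ({2, 4}, {0, 1, 2, 4, 5, 6}), ({7}, {0, 1, 5, 6, 7, 8}),
    ({2, 4}, {0, 1, 2, 4, 5, 6, 8})}

/-- The first partner of a positive class `(∅, U)`: `v–H` (edge `7`) copied into both copies,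
`v–m₂, a–H` (edges `2, 4`) into neither. -/
def P₁ (C : Finset (Fin 9) × Finset (Fin 9)) : Finset (Fin 9) × Finset (Fin 9) :=
  ({7}, C.2 \ {2, 4})

/-- The second partner: `v–m₂, a–H` copied into both copies, `v–H` into neither. -/
def P₂ (C : Finset (Fin 9) × Finset (Fin 9)) : Finset (Fin 9) × Finset (Fin 9) :=
  ({2, 4}, C.2 \ {7})

/-- First partner class of the first negative class (kernel-checked). -/
theorem P₁_neg₁ : P₁ (∅, {0, 1, 2, 4, 5, 6, 7}) = ({7}, {0, 1, 5, 6, 7}) := by decide +kernel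
/-- Second partner class of the first negative class (kernel-checked). -/
theorem P₂_neg₁ : P₂ (∅, {0, 1, 2, 4, 5, 6, 7}) = ({2, 4}, {0, 1, 2, 4, 5, 6}) := by decide +kernel
/-- First partner class of the second negative class (kernel-checked). -/
theorem P₁_neg₂ : P₁ (∅, {0, 1, 2, 4, 5, 6, 7, 8}) = ({7}, {0, 1, 5, 6, 7, 8}) := by decide +kernel
/-- Second partner class of the second negative class (kernel-checked). -/
theorem P₂_neg₂ : P₂ (∅, {0, 1, 2, 4, 5, 6, 7, 8}) = ({2, 4}, {0, 1, 2, 4, 5, 6, 8}) := by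
  decide +kernel

/-- Shares: each positive class takes all of its own two partners. -/
noncomputable def shC (C IU : Finset (Fin 9) × Finset (Fin 9)) : ℝ :=
  if IU = P₁ C ∨ IU = P₂ C then 1 else 0

/-- The share is `1` on the two partner classes. -/
theorem shC_eq_one {C IU : Finset (Fin 9) × Finset (Fin 9)} (h : IU = P₁ C ∨ IU = P₂ C) :
    shC C IU = 1 := if_pos h

/-- The share is `0` off the two partner classes. -/
theorem shC_eq_zero {C IU : Finset (Fin 9) × Finset (Fin 9)} (h : ¬ (IU = P₁ C ∨ IU = P₂ C)) :
    shC C IU = 0 := if_neg h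

/-- The two negative classes are distinct (kernel-checked). -/
theorem negC_ne : ((∅ : Finset (Fin 9)), ({0, 1, 2, 4, 5, 6, 7} : Finset (Fin 9))) ≠
    (∅, {0, 1, 2, 4, 5, 6, 7, 8}) := by decide +kernel

/-- A special class is negative or paying. -/
theorem mem_specials_imp {C : Finset (Fin 9) × Finset (Fin 9)} (h : C ∈ specials) :
    C ∈ negC ∨ C ∈ payC := by
  simp only [specials, List.mem_cons, List.not_mem_nil, or_false] at h
  rcases h with rfl | rfl | rfl | rfl | rfl | rfl
  · exact Or.inl (by simp [negC])
  · exact Or.inl (by simp [negC])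
  · exact Or.inr (by simp [payC])
  · exact Or.inr (by simp [payC])
  · exact Or.inr (by simp [payC])
  · exact Or.inr (by simp [payC])

/-- Membership in the list of negative classes, explicitly. -/
theorem mem_negC_iff (C : Finset (Fin 9) × Finset (Fin 9)) :
    C ∈ negC ↔ C = (∅, {0, 1, 2, 4, 5, 6, 7}) ∨ C = (∅, {0, 1, 2, 4, 5, 6, 7, 8}) := by
  simp [negC]

/-- Membership in the list of paying classes, explicitly. -/
theorem mem_payC_iff (IU : Finset (Fin 9) × Finset (Fin 9)) :
    IU ∈ payC ↔ IU = ({7}, {0, 1, 5, 6, 7}) ∨ IU = ({2, 4}, {0, 1, 2, 4, 5, 6}) ∨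
      IU = ({7}, {0, 1, 5, 6, 7, 8}) ∨ IU = ({2, 4}, {0, 1, 2, 4, 5, 6, 8}) := by
  simp [payC]

/-- The nested sums of the six classes of the certificate. -/
theorem nestedSum_specials (p : Fin 9 → ℝ) :
    g3.nestedSum p S3 3 0 1 2 3 ∅ {0, 1, 2, 4, 5, 6, 7} = 1 ∧
    g3.nestedSum p S3 3 0 1 2 3 ∅ {0, 1, 2, 4, 5, 6, 7, 8} = 1 ∧
    g3.nestedSum p S3 3 0 1 2 3 {7} {0, 1, 5, 6, 7} = -1 ∧
    g3.nestedSum p S3 3 0 1 2 3 {2, 4} {0, 1, 2, 4, 5, 6} = -1 ∧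
    g3.nestedSum p S3 3 0 1 2 3 {7} {0, 1, 5, 6, 7, 8} = -1 ∧
    g3.nestedSum p S3 3 0 1 2 3 {2, 4} {0, 1, 2, 4, 5, 6, 8} = -1 := by
  obtain ⟨h1, h2, h3, h4, h5, h6⟩ := cT_specials
  refine ⟨?_, ?_, ?_, ?_, ?_, ?_⟩ <;> rw [nestedSum_g3 p (by decide +kernel) (by decide +kernel)]
  · rw [h1]; norm_num
  · rw [h2]; norm_num
  · rw [h3]; norm_num
  · rw [h4]; norm_num
  · rw [h5]; norm_num
  · rw [h6]; norm_num

/-- **Lemma 5 on `g3 = gadget + v–m₄` for every weight vector**: `Q⁺(Δ_g, Δ_g) ≤ 0` along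
`g = a–v` for every `p ∈ [0, 1]⁹`, by the class-level pair certificate. -/
theorem g3_deltaQuad_nonpos (p : Fin 9 → ℝ) (hp : IsProb p) :
    g3.deltaQuad p 3 0 1 2 3 ≤ 0 := by
  obtain ⟨n1, n2, n3, n4, n5, n6⟩ := nestedSum_specials p
  refine g3.deltaQuad_nonpos_of_pairs hp three_notMem_S3 0 1 2 3 negC payC ?_ ?_ (by decide)
    P₁ P₂ shC ?_ ?_ ?_ ?_ ?_ ?_ ?_
  · -- negC ⊆ P
    intro C hC
    rcases (mem_negC_iff C).mp hC with rfl | rfl <;>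
      exact Finset.mem_product.mpr ⟨Finset.mem_powerset.mpr (by decide +kernel),
        Finset.mem_powerset.mpr (by decide +kernel)⟩
  · -- payC ⊆ P
    intro C hC
    rcases (mem_payC_iff C).mp hC with rfl | rfl | rfl | rfl <;>
      exact Finset.mem_product.mpr ⟨Finset.mem_powerset.mpr (by decide +kernel),
        Finset.mem_powerset.mpr (by decide +kernel)⟩
  · -- partners in payC, distinct
    intro C hC
    rcases (mem_negC_iff C).mp hC with rfl | rfl
    · rw [P₁_neg₁, P₂_neg₁]
      exact ⟨(mem_payC_iff _).mpr (by simp), (mem_payC_iff _).mpr (by simp), by decide +kernel⟩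
    · rw [P₁_neg₂, P₂_neg₂]
      exact ⟨(mem_payC_iff _).mpr (by simp), (mem_payC_iff _).mpr (by simp), by decide +kernel⟩
  · -- the weight identity
    intro C hC
    rcases (mem_negC_iff C).mp hC with rfl | rfl
    · rw [P₁_neg₁, P₂_neg₁]
      exact patWeight_pair_of_profile p S3 (by decide +kernel)
    · rw [P₁_neg₂, P₂_neg₂]
      exact patWeight_pair_of_profile p S3 (by decide +kernel)
  · -- shares nonnegative
    intro C IU
    unfold shC
    split_ifs <;> norm_num
  · -- total share ≤ 1 on every paying class
    intro IU hIU
    rw [negC, Finset.sum_pair negC_ne]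
    rcases (mem_payC_iff IU).mp hIU with rfl | rfl | rfl | rfl
    · rw [shC_eq_one (by decide +kernel), shC_eq_zero (by decide +kernel)]; norm_num
    · rw [shC_eq_one (by decide +kernel), shC_eq_zero (by decide +kernel)]; norm_num
    · rw [shC_eq_zero (by decide +kernel), shC_eq_one (by decide +kernel)]; norm_num
    · rw [shC_eq_zero (by decide +kernel), shC_eq_one (by decide +kernel)]; norm_num
  · -- the paying classes are nonpositive
    intro IU hIU
    rcases (mem_payC_iff IU).mp hIU with rfl | rfl | rfl | rfl <;> linarith
  · -- the discriminants
    intro C hC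
    rcases (mem_negC_iff C).mp hC with rfl | rfl
    · rw [shC_eq_one (Or.inl rfl), shC_eq_one (Or.inr rfl), P₁_neg₁, P₂_neg₁, n1, n3, n4]; norm_num
    · rw [shC_eq_one (Or.inl rfl), shC_eq_one (Or.inr rfl), P₁_neg₂, P₂_neg₂, n2, n5, n6]; norm_num
  · -- every other class is nonpositive
    intro IU hIU hn hpay
    obtain ⟨hI, hU⟩ := Finset.mem_product.mp hIU
    by_cases hsub : IU.1 ⊆ IU.2
    · rw [nestedSum_g3 p hsub (Finset.mem_powerset.mp hU)]
      have hspec : (IU.1, IU.2) ∉ specials := by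
        intro h
        rcases mem_specials_imp h with h' | h'
        · exact hn (by simpa using h')
        · exact hpay (by simpa using h')
      have := cT_nonpos IU.1 hI IU.2 hU hsub hspec
      have h' : ((cT IU.1 IU.2 : ℤ) : ℝ) ≤ 0 := by exact_mod_cast this
      linarith
    · rw [g3.nestedSum_eq_zero_of_not_subset p S3 3 0 1 2 3 hsub]

/-- **The C-011 slack is concave in the weight of `g = a–v` on `g3`**, for every `p`. -/
theorem g3_phiPlus_concave (p : Fin 9 → ℝ) (hp : IsProb p) :
    ConcaveOn ℝ (Set.Icc (0 : ℝ) 1) (fun t => g3.PhiPlus (Function.update p 3 t) 0 1 2 3) :=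
  (g3.concaveOn_phiPlus_iff p 3 0 1 2 3).mpr (g3_deltaQuad_nonpos p hp)

end PercRepro
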